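import Summits.Schanuel.Schanuel.Theses.DiophantineDichotomy
import Literature.NumberTheory.Transcendental.PhilipponCriterionProofs

/-!
# Sketch — crux-ideate round 2, ideator 4: the bounded-degree race ("operating point II")

Crux: `Summit.Schanuel.Schanuel.Theses.DiophantineDichotomy.EPiSimultaneousType`.
Card: `Cruxes/EPiSimultaneousType/Ideas/bounded-degree-race.md`.
-/

set_option linter.unusedVariables false
set_option linter.dupNamespace false

noncomputable section

namespace Summit.Schanuel.Schanuel.Cruxes.EPiSimultaneousType.BoundedDegreeRace

open Summit.Schanuel.Schanuel.Theses.DiophantineDichotomy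
open Polynomial

/-- The base point `θ = (π, e)`, exactly as in the crux. -/
def θ : Fin 2 → ℂ := ![(Real.pi : ℂ), (Real.exp 1 : ℂ)]

/-- The crux's clause for one coordinate: `z` is a root of a non-zero integer polynomial of
degree `≤ d` and naive height `≤ H`. -/
def Clause (d H : ℕ) (z : ℂ) : Prop :=
  ∃ P : Polynomial ℤ, P ≠ 0 ∧ P.natDegree ≤ d ∧ (∀ k, |P.coeff k| ≤ (H : ℤ)) ∧
    Polynomial.aeval z P = 0

/-- The admissibility clause of the crux for `(d, H, γ)` (verbatim). -/
def Admissible (d H : ℕ) (γ : Fin 2 → ℂ) : Prop :=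
  Module.finrank ℚ ↥(IntermediateField.adjoin ℚ (Set.range γ)) ≤ d ∧ ∀ i, Clause d H (γ i)

/-- READ-BACK: the crux, unfolded over `Admissible`. -/
theorem crux_iff : EPiSimultaneousType ↔ ∃ a b C : ℝ, a < 1 ∧ 0 < C ∧ ∀ (d H : ℕ) (γ : Fin 2 → ℂ),
    Admissible d H γ →
      Real.exp (-(C * ((d : ℝ) ^ a * Real.log H + (d : ℝ) ^ b))) ≤ ‖γ - θ‖ := by
  simp only [EPiSimultaneousType, Admissible, Clause, θ, and_imp]

/-- The clause forces `d ≥ 1` and `H ≥ 1`. [folklore] -/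
theorem one_le_of_clause {d H : ℕ} {z : ℂ} (h : Clause d H z) : 1 ≤ d ∧ 1 ≤ H := by
  obtain ⟨P, hP0, hdeg, hH, hroot⟩ := h
  constructor
  · by_contra hd
    have hd0 : P.natDegree = 0 := by omega
    rw [Polynomial.eq_C_of_natDegree_eq_zero hd0] at hroot
    simp at hroot
    apply hP0
    rw [Polynomial.eq_C_of_natDegree_eq_zero hd0, hroot, map_zero]
  · by_contra hH0
    have : H = 0 := by omega
    subst this
    apply hP0
    ext k
    have := hH k
    simp only [CharP.cast_eq_zero, abs_nonpos_iff] at this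
    simp [this]

theorem one_le_of_admissible {d H : ℕ} {γ : Fin 2 → ℂ} (h : Admissible d H γ) :
    1 ≤ d ∧ 1 ≤ H := one_le_of_clause (h.2 0)

/-- **Joint approximation type of `(π, e)` at degree `d` is at most `κ`** (classical constant
form, per degree): `‖γ − θ‖ ≥ c₀ · H^{−κ}` for every admissible challenger at level `d`, with a
constant `c₀ = c₀(d, κ) > 0` — no uniformity in `d`, no control of `c₀`. -/
def JointTypeLE (d : ℕ) (κ : ℝ) : Prop :=
  ∃ c₀ : ℝ, 0 < c₀ ∧ ∀ (H : ℕ) (γ : Fin 2 → ℂ), Admissible d H γ → c₀ * (H : ℝ) ^ (-κ) ≤ ‖γ - θ‖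

/-- **JointTypeSublinear** (what the route actually consumes of the crux): finite joint type in
every degree, and joint type `≤ ε d` in every large degree, for every `ε > 0`. -/
def JointTypeSublinear : Prop :=
  (∀ d : ℕ, ∃ κ : ℝ, JointTypeLE d κ) ∧
    ∀ ε : ℝ, 0 < ε → ∃ d₀ : ℕ, ∀ d : ℕ, d₀ ≤ d → JointTypeLE d (ε * d)

/-- The hypothesis of the support item `EPiRace` (stmt-Schanuel-11044), verbatim: the level-1
approximation property AT `θ = (π, e)` under `trdeg ℚ(π, e) ≤ 1`. -/
def AP1Hyp : Prop :=
  Algebra.trdeg ℚ ↥(IntermediateField.adjoin ℚ (Set.range ![(Real.pi : ℂ), (Real.exp 1 : ℂ)]))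
      ≤ (1 : Cardinal) →
    ∃ c : ℝ, 1 ≤ c ∧ ∀ Δ Y : ℝ, c ≤ Δ → Δ ≤ Y →
      ∃ (γ : Fin 2 → ℂ) (d H : ℕ),
        Module.finrank ℚ ↥(IntermediateField.adjoin ℚ (Set.range γ)) ≤ d ∧
        (∀ i, ∃ P : Polynomial ℤ, P ≠ 0 ∧ P.natDegree ≤ d ∧ (∀ k, |P.coeff k| ≤ (H : ℤ)) ∧
          Polynomial.aeval (γ i) P = 0) ∧
        (d : ℝ) ≤ c * Δ ∧ Real.log H ≤ c * Y ∧
        ‖γ - ![(Real.pi : ℂ), (Real.exp 1 : ℂ)]‖ ≤ Real.exp (-((Real.log H * Δ + d * Y) / c))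

/-- READ-BACK: `EPiRace` is literally `AP1Hyp → crux → e ⊥ π`. -/
theorem epiRace_iff :
    EPiRace ↔ (AP1Hyp → EPiSimultaneousType → AlgebraicIndependent ℚ ![Real.exp 1, Real.pi]) :=
  Iff.rfl

/-! ## (L1) The typed crux implies `JointTypeSublinear` -/

/-- Core inequality: if `κ ≥ C dᵃ` (as reals, with `d ≥ 1`, `H ≥ 1`, `C ≥ 0`) then
`exp(−C dᵇ) · H^{−κ} ≤ exp(−C(dᵃ log H + dᵇ))`. [folklore] -/
theorem bound_le_of_exponent {a b C κ : ℝ} {d H : ℕ} (hd : 1 ≤ d) (hH : 1 ≤ H) (hC : 0 ≤ C)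
    (hκ : C * (d : ℝ) ^ a ≤ κ) :
    Real.exp (-(C * (d : ℝ) ^ b)) * (H : ℝ) ^ (-κ) ≤
      Real.exp (-(C * ((d : ℝ) ^ a * Real.log H + (d : ℝ) ^ b))) := by
  have hHpos : (0 : ℝ) < H := by exact_mod_cast hH
  have hlog : 0 ≤ Real.log H := Real.log_natCast_nonneg H
  rw [Real.rpow_def_of_pos hHpos, ← Real.exp_add]
  apply Real.exp_le_exp.mpr
  have : C * (d : ℝ) ^ a * Real.log H ≤ κ * Real.log H := by gcongr
  nlinarith

theorem jointTypeSublinear_of_crux (h : EPiSimultaneousType) : JointTypeSublinear := by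
  obtain ⟨a, b, C, ha, hC, hM⟩ := crux_iff.mp h
  -- replace `a` by `a⁺ = max a 0 ∈ [0, 1)`
  set a' : ℝ := max a 0 with ha'def
  have ha'0 : 0 ≤ a' := le_max_right _ _
  have ha'1 : a' < 1 := max_lt ha one_pos
  have hda : ∀ d : ℕ, 1 ≤ d → (d : ℝ) ^ a ≤ (d : ℝ) ^ a' := fun d hd =>
    Real.rpow_le_rpow_of_exponent_le (by exact_mod_cast hd) (le_max_left _ _)
  -- the measure at level d, with exponent κ ≥ C d^{a'}
  have key : ∀ (d : ℕ) (κ : ℝ), C * (d : ℝ) ^ a' ≤ κ → JointTypeLE d κ := by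
    intro d κ hκ
    refine ⟨Real.exp (-(C * (d : ℝ) ^ b)), Real.exp_pos _, fun H γ hadm => ?_⟩
    obtain ⟨hd, hH⟩ := one_le_of_admissible hadm
    have hκ' : C * (d : ℝ) ^ a ≤ κ := le_trans (mul_le_mul_of_nonneg_left (hda d hd) hC.le) hκ
    exact (bound_le_of_exponent hd hH hC.le hκ').trans (hM d H γ hadm)
  refine ⟨fun d => ⟨C * (d : ℝ) ^ a', key d _ le_rfl⟩, fun ε hε => ?_⟩
  -- C d^{a'} ≤ ε d eventually, since a' < 1
  have ht : Filter.Tendsto (fun x : ℝ => C * x ^ (-(1 - a'))) Filter.atTop (nhds 0) := by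
    have := (tendsto_rpow_neg_atTop (show 0 < 1 - a' by linarith)).const_mul C
    simpa using this
  have hev : ∀ᶠ n : ℕ in Filter.atTop, C * (n : ℝ) ^ (-(1 - a')) ≤ ε :=
    (ht.comp tendsto_natCast_atTop_atTop).eventually (ge_mem_nhds hε)
  obtain ⟨d₀, hd₀⟩ := Filter.eventually_atTop.1 ((Filter.eventually_ge_atTop 1).and hev)
  refine ⟨d₀, fun d hd => key d _ ?_⟩
  obtain ⟨hd1, hdε⟩ := hd₀ d hd
  have hdpos : (0 : ℝ) < d := by exact_mod_cast hd1
  have hsplit : (d : ℝ) ^ a' = (d : ℝ) ^ (-(1 - a')) * d := by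
    rw [← Real.rpow_add_one hdpos.ne']
    congr 1
    ring
  calc C * (d : ℝ) ^ a' = C * (d : ℝ) ^ (-(1 - a')) * d := by rw [hsplit]; ring
    _ ≤ ε * d := by gcongr

/-! ## (L2) The race at operating point II (fixed `Δ₀`, `Y → ∞`) -/

/-- `trdeg ℚ(π, e) ≥ 2 ⇒ (π, e)` algebraically independent. [folklore] (as in Disproof.lean §3) -/
theorem algebraicIndependent_theta_of_two_le_trdeg
    (h : ((2 : ℕ) : Cardinal) ≤ Algebra.trdeg ℚ ↥(IntermediateField.adjoin ℚ (Set.range θ))) :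
    AlgebraicIndependent ℚ θ := by
  set K := IntermediateField.adjoin ℚ (Set.range θ) with hK
  let x : Fin 2 → K := fun i => ⟨θ i, IntermediateField.subset_adjoin ℚ _ ⟨i, rfl⟩⟩
  have hx : Set.range x = ((↑) : K → ℂ) ⁻¹' Set.range θ := by
    ext ⟨z, hz⟩
    simp only [Set.mem_range, Set.mem_preimage]
    constructor
    · rintro ⟨i, hi⟩; exact ⟨i, congrArg Subtype.val hi⟩
    · rintro ⟨i, hi⟩; exact ⟨i, Subtype.ext hi⟩
  haveI : Algebra.IsAlgebraic (Algebra.adjoin ℚ (Set.range x)) K := by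
    rw [hx]
    exact Literature.NumberTheory.Transcendental.isAlgebraic_adjoin_over_algebraAdjoin
      (F := ℚ) (Set.range θ)
  have hcard : Cardinal.mk (Fin 2) ≤ Algebra.trdeg ℚ K := by simpa using h
  have hB := Algebra.IsAlgebraic.isTranscendenceBasis_of_le_trdeg_of_finite ℚ x hcard
  exact hB.1.map' (f := K.val) (fun a b hab => Subtype.ext hab)

/-- `¬ (e, π algebraically independent over ℚ in ℝ) ⇒ trdeg ℚ(π, e) ≤ 1`. [folklore] -/
theorem trdeg_le_one_of_not_algebraicIndependent
    (hnot : ¬ AlgebraicIndependent ℚ ![Real.exp 1, Real.pi]) :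
    Algebra.trdeg ℚ ↥(IntermediateField.adjoin ℚ (Set.range θ)) ≤ (1 : Cardinal) := by
  by_contra hlt
  have h2 : ((2 : ℕ) : Cardinal) ≤ Algebra.trdeg ℚ ↥(IntermediateField.adjoin ℚ (Set.range θ)) := by
    have h2' : (2 : Cardinal) ≤ _ := Cardinal.two_le_iff_one_lt.mpr (not_le.mp hlt)
    exact_mod_cast h2'
  have hθ := algebraicIndependent_theta_of_two_le_trdeg h2
  have hswap : AlgebraicIndependent ℚ (θ ∘ ![(1 : Fin 2), 0]) :=
    hθ.comp _ (by decide)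
  let f : ℝ →ₐ[ℚ] ℂ := Complex.ofRealAm.restrictScalars ℚ
  have hf : Function.Injective f := Complex.ofReal_injective
  have heq : f ∘ ![Real.exp 1, Real.pi] = θ ∘ ![(1 : Fin 2), 0] := by
    ext i
    fin_cases i <;> simp [f, θ]
  apply hnot
  rw [← AlgHom.algebraicIndependent_iff f hf, heq]
  exact hswap

/-- (L2) **The race at operating point II.** The level-1 approximation property at `(π, e)` and
`JointTypeSublinear` are incompatible with `trdeg ℚ(π, e) ≤ 1`: choose `ε = 1/(2c²)`,
`d₀ = d₀(ε)`, `Δ₀ = max(c, c(S+1))` with `S ≥ κ_d` for `d < d₀`, a uniform constant `μ` for the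
finitely many degrees `d ≤ cΔ₀`, and `Y > c log(1/μ)`; the AP-output at `(Δ₀, Y)` has `d ≤ cΔ₀`
and `dist ≤ H^{−Δ₀/c} e^{−dY/c} ≤ H^{−κ'(d)} e^{−Y/c} < μ H^{−κ'(d)} ≤ dist`. Pure real analysis;
no finiteness of the set of challengers is needed in the constant form. [folklore] -/
theorem epiRace_pointII (hAP : AP1Hyp) (hJ : JointTypeSublinear) :
    AlgebraicIndependent ℚ ![Real.exp 1, Real.pi] := by
  by_contra hnot
  have htr := trdeg_le_one_of_not_algebraicIndependent hnot
  obtain ⟨c, hc1, hAP⟩ := hAP htr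
  have hc0 : 0 < c := by linarith
  obtain ⟨hfin, hsub⟩ := hJ
  obtain ⟨d₀, hd₀⟩ := hsub (1 / (2 * c ^ 2)) (by positivity)
  choose κ hκ using hfin
  set κ' : ℕ → ℝ := fun d => if d < d₀ then κ d else 1 / (2 * c ^ 2) * d with hκ'def
  have hJ' : ∀ d, JointTypeLE d (κ' d) := by
    intro d
    show JointTypeLE d (if d < d₀ then κ d else 1 / (2 * c ^ 2) * d)
    split_ifs with h
    · exact hκ d
    · exact hd₀ d (not_lt.mp h)
  choose c₀ hc₀pos hc₀ using hJ'
  -- a bound S for the exponents below d₀, and the fixed Δ₀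
  set S : ℝ := ∑ i ∈ Finset.range d₀, |κ i| with hSdef
  have hκS : ∀ d, d < d₀ → κ d ≤ S := fun d hd =>
    (le_abs_self _).trans
      (Finset.single_le_sum (f := fun i => |κ i|) (fun i _ => abs_nonneg _)
        (Finset.mem_range.mpr hd))
  have hS0 : 0 ≤ S := Finset.sum_nonneg fun i _ => abs_nonneg _
  set Δ₀ : ℝ := max c (c * (S + 1)) with hΔ₀def
  have hΔc : c ≤ Δ₀ := le_max_left _ _
  have hΔ0 : 0 < Δ₀ := lt_of_lt_of_le hc0 hΔc
  have hκ'le : ∀ d : ℕ, (d : ℝ) ≤ c * Δ₀ → κ' d ≤ Δ₀ / c := by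
    intro d hd
    show (if d < d₀ then κ d else 1 / (2 * c ^ 2) * d) ≤ Δ₀ / c
    split_ifs with h
    · have h1 : S + 1 ≤ Δ₀ / c := by
        rw [le_div_iff₀ hc0]
        calc (S + 1) * c = c * (S + 1) := by ring
          _ ≤ Δ₀ := le_max_right _ _
      linarith [hκS d h]
    · calc 1 / (2 * c ^ 2) * (d : ℝ) ≤ 1 / (2 * c ^ 2) * (c * Δ₀) := by gcongr
        _ = Δ₀ / (2 * c) := by field_simp
        _ ≤ Δ₀ / c := div_le_div_of_nonneg_left hΔ0.le hc0 (by linarith)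
  -- a uniform constant for the finitely many degrees d ≤ D
  set D : ℕ := ⌊c * Δ₀⌋₊ with hDdef
  set T : ℝ := ∑ i ∈ Finset.range (D + 1), (c₀ i)⁻¹ with hTdef
  have hT0 : 0 < T :=
    Finset.sum_pos (fun i _ => inv_pos.mpr (hc₀pos i)) ⟨0, Finset.mem_range.mpr (Nat.succ_pos _)⟩
  have hμ : ∀ d, d ≤ D → T⁻¹ ≤ c₀ d := by
    intro d hd
    have h1 : (c₀ d)⁻¹ ≤ T :=
      Finset.single_le_sum (f := fun i => (c₀ i)⁻¹) (fun i _ => (inv_pos.mpr (hc₀pos i)).le)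
        (Finset.mem_range.mpr (Nat.lt_succ_of_le hd))
    exact (inv_le_comm₀ hT0 (hc₀pos d)).mpr h1
  -- run the approximation property at (Δ₀, Y) with Y large
  set Y : ℝ := max Δ₀ (c * |Real.log T| + c + 1) with hYdef
  have hΔY : Δ₀ ≤ Y := le_max_left _ _
  have hY0 : 0 ≤ Y := hΔ0.le.trans hΔY
  obtain ⟨γ, d, H, hfinrk, hcl, hdle, -, hdist⟩ := hAP Δ₀ Y hΔc hΔY
  have hadm : Admissible d H γ := ⟨hfinrk, hcl⟩
  obtain ⟨hd1, hH1⟩ := one_le_of_admissible hadm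
  have hd1' : (1 : ℝ) ≤ d := by exact_mod_cast hd1
  have hHpos : (0 : ℝ) < H := by exact_mod_cast hH1
  have hlog : 0 ≤ Real.log H := Real.log_natCast_nonneg H
  have hdD : d ≤ D := Nat.le_floor hdle
  have hκd : κ' d ≤ Δ₀ / c := hκ'le d hdle
  -- lower bound from the joint type, upper bound from the approximation property
  have hlow : T⁻¹ * Real.exp (Real.log H * (-κ' d)) ≤ ‖γ - θ‖ := by
    have h1 := hc₀ d H γ hadm
    rw [Real.rpow_def_of_pos hHpos] at h1
    refine le_trans ?_ h1
    gcongr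
    exact hμ d hdD
  have hup : ‖γ - θ‖ ≤ Real.exp (Real.log H * (-κ' d)) * Real.exp (-(Y / c)) := by
    have hdist' : ‖γ - θ‖ ≤ Real.exp (-((Real.log H * Δ₀ + d * Y) / c)) := hdist
    refine hdist'.trans ?_
    rw [← Real.exp_add, Real.exp_le_exp]
    have h1 : Real.log H * κ' d ≤ Real.log H * Δ₀ / c := by
      rw [mul_div_assoc]
      exact mul_le_mul_of_nonneg_left hκd hlog
    have h2 : Y / c ≤ d * Y / c := by
      rw [div_le_div_iff_of_pos_right hc0]
      nlinarith
    have h3 : (Real.log H * Δ₀ + d * Y) / c = Real.log H * Δ₀ / c + d * Y / c := by ring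
    rw [h3]
    linarith
  have hcmp : T⁻¹ ≤ Real.exp (-(Y / c)) := by
    have h := hlow.trans hup
    rw [mul_comm] at h
    exact le_of_mul_le_mul_left h (Real.exp_pos _)
  -- but Y > c log T
  have hlt : Real.exp (-(Y / c)) < T⁻¹ := by
    rw [← Real.exp_log (inv_pos.mpr hT0), Real.exp_lt_exp, Real.log_inv, neg_lt_neg_iff,
      lt_div_iff₀ hc0]
    have h1 : Real.log T * c ≤ |Real.log T| * c :=
      mul_le_mul_of_nonneg_right (le_abs_self _) hc0.le
    have h2 : c * |Real.log T| + c + 1 ≤ Y := le_max_right _ _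
    linarith
  linarith

/-- Hence **the crux is consumed by the route only through `JointTypeSublinear`**: a complete,
sorry-free proof of the support item `EPiRace` (stmt-Schanuel-11044) factoring through (L1) and
(L2) — a different kernel from Disproof.lean's `epiRace_kernel` (which races at `Y ≍ Δ^{b−1}`).
Not proposed for landing here (prover's item); evidence only. -/
theorem epiRace_via_pointII : EPiRace :=
  fun hAP hcrux => epiRace_pointII hAP (jointTypeSublinear_of_crux hcrux)

/-! ## Calibration: what single-number theory gives (printed inputs, to vendor) -/

/-- Popken 1929 / Mahler 1932 (Bugeaud 2004 (3.32), p. 83: `|P(e)| ≥ H^{-n-c₉(n)/log log H}` for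
`H` large, hence `w_n(e) = n` and `e` is an `S*`-number of `*`-type 1, Cor. 3.2), in the crux's
clause currency and in constant form: for every degree `d` and `η > 0` there is `c₀(d, η) > 0`
with `|e − z| ≥ c₀ · H^{−(d+1+η)}` whenever `Clause d H z`. UNPROVED in tree (named fact). -/
def MahlerPopkenE : Prop :=
  ∀ (d : ℕ) (η : ℝ), 0 < η → ∃ c₀ : ℝ, 0 < c₀ ∧ ∀ (H : ℕ) (z : ℂ), Clause d H z →
    c₀ * (H : ℝ) ^ (-((d : ℝ) + 1 + η)) ≤ ‖z - (Real.exp 1 : ℂ)‖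

/-- Waldschmidt 1978 / Fel'dman (Bugeaud 2004 p. 183: `3·2^{38} n (log M + n log n)(1 + log n)`
is a measure of algebraic approximation for `π`), in constant form per degree:
`|π − z| ≥ c₀(d) · H^{−c d (1 + log d)}`. UNPROVED in tree (named fact; = NW1996 Thm 2). -/
def FeldmanPi : Prop :=
  ∃ c : ℝ, 0 < c ∧ ∀ d : ℕ, 1 ≤ d → ∃ c₀ : ℝ, 0 < c₀ ∧ ∀ (H : ℕ) (z : ℂ), Clause d H z →
    c₀ * (H : ℝ) ^ (-(c * d * (1 + Real.log d))) ≤ ‖z - (Real.pi : ℂ)‖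

/-- (C1) **`e` alone already gives finite, LINEAR joint type `κ(d) ≤ d + 2`**: the sup norm
dominates the `e`-coordinate, whose clause is the clause of `MahlerPopkenE`. So the entire
content of the `n = 2` layer of the route is the passage `d + 2 ↦ o(d)`. [folklore] -/
theorem jointTypeLE_of_mahlerPopkenE (hMP : MahlerPopkenE) (d : ℕ) :
    JointTypeLE d ((d : ℝ) + 2) := by
  obtain ⟨c₀, hc₀, hc⟩ := hMP d 1 one_pos
  refine ⟨c₀, hc₀, fun H γ hadm => ?_⟩
  have h1 := hc H (γ 1) (hadm.2 1)
  have hcomp : ‖γ 1 - (Real.exp 1 : ℂ)‖ ≤ ‖γ - θ‖ := by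
    have := norm_le_pi_norm (γ - θ) 1
    simpa [θ] using this
  have hexp : ((d : ℝ) + 1 + 1) = (d : ℝ) + 2 := by ring
  rw [hexp] at h1
  exact h1.trans hcomp

/-! ## Pricing at operating point II: per-degree transcendence type of the PAIR, sub-cubic -/

/-- Transcendence type of the pair `(π, e)` in total degree `k` is at most `τ` (constant form):
`|Q(π, e)| ≥ c₀ · H(Q)^{−τ}` for every non-zero `Q ∈ ℤ[x, y]` of total degree `≤ k` and naive
height `≤ Hq`. -/
def PairTypeLE (k : ℕ) (τ : ℝ) : Prop :=
  ∃ c₀ : ℝ, 0 < c₀ ∧ ∀ (Q : MvPolynomial (Fin 2) ℤ) (Hq : ℕ), Q ≠ 0 → Q.totalDegree ≤ k →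
    (∀ m, |Q.coeff m| ≤ (Hq : ℤ)) → c₀ * (Hq : ℝ) ^ (-τ) ≤ ‖MvPolynomial.aeval θ Q‖

/-- **PairTypeSubcubic** — the single open input at operating point II (Dirichlet forces
`τ(k) ≥ (k+1)(k+2)/2 − 1`; generic truth `≍ k²`): finite pair type in every degree and
`τ(k) · log k ≤ ε k³` for large `k`. OPEN: contains `e ⊥ π` (even `1, π, e` ℚ-linearly
independent, at `k = 1`). -/
def PairTypeSubcubic : Prop :=
  (∀ k : ℕ, ∃ τ : ℝ, PairTypeLE k τ) ∧
    ∀ ε : ℝ, 0 < ε → ∃ k₀ : ℕ, ∀ k : ℕ, k₀ ≤ k → PairTypeLE k (ε * (k : ℝ) ^ 3 / Real.log k)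

/-- The relative Siegel lemma over `ℚ` in the intermediate window (Bombieri–Gubler Thm 2.9.19 with
`K = ℚ`, `F = ℚ(γ)`; = the stub `SiegelRelation` of card `siegel-window-transfer`, SHARED with the
merged round-1 line): an admissible `γ` of field degree `r`, coordinate degrees `d₁, d₂ ≥ 1`,
satisfies a non-zero integer relation of total degree `≤ δ` and log-height
`≤ (4r/δ)(L/d₁ + L/d₂) + 2 log(δ+2)`, `L = log H + d + log(d+1)`, whenever `4r ≤ (δ+1)(δ+2)`.
UNPROVED in tree (provable now after vendoring B–G 2.9.19). -/
def SiegelRelation : Prop :=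
  ∀ (d H r d₁ d₂ δ : ℕ) (γ : Fin 2 → ℂ), Admissible d H γ →
    Module.finrank ℚ ↥(IntermediateField.adjoin ℚ (Set.range γ)) = r →
    Module.finrank ℚ ↥(IntermediateField.adjoin ℚ ({γ 0} : Set ℂ)) = d₁ →
    Module.finrank ℚ ↥(IntermediateField.adjoin ℚ ({γ 1} : Set ℂ)) = d₂ →
    1 ≤ d₁ → 1 ≤ d₂ → 1 ≤ δ → 4 * r ≤ (δ + 1) * (δ + 2) →
    ∃ (Q : MvPolynomial (Fin 2) ℤ) (Hq : ℕ), Q ≠ 0 ∧ Q.totalDegree ≤ δ ∧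
      MvPolynomial.aeval γ Q = 0 ∧ (∀ m, |Q.coeff m| ≤ (Hq : ℤ)) ∧
      Real.log Hq ≤ (4 * r / δ) * ((Real.log H + d + Real.log (d + 1)) / d₁ +
        (Real.log H + d + Real.log (d + 1)) / d₂) + 2 * Real.log (δ + 2)

/-- (P1) **The transfer at operating point II**: per-degree sub-cubic pair type, the two printed
single-number corners and the shared Siegel relation give `JointTypeSublinear`. At FIXED `d`,
for a violating family (`dist < c₀ H^{−εd}`): `d₂ ≤ εd − 2` dies by `MahlerPopkenE`;
`d₁ ≤ εd/(c(1+log d))` dies by `FeldmanPi`; otherwise `δ = ⌈2√r⌉ + 1`,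
`log H(Q₀) ≤ A_d log H + B_d` with `A_d ≤ 4c(1+log d)/(ε^{3/2}√d)`, the mean-value bound
`|Q₀(θ)| ≤ N_δ H(Q₀) δ 4·2^δ ‖γ − θ‖`, so `log(1/|Q₀(θ)|) ≥ (εd/A_d − 1) log H(Q₀) − B'_d` and
`εd/A_d ≍ ε δ³/(32 c log d)` beats `τ(δ) ≤ ε' δ³/log δ`. NO e-side gap, NO box currency,
NO uniform constants, NO additive-term bookkeeping. Paper proof in the card; size M–L. -/
theorem jointTypeSublinear_of_pairType (hS : SiegelRelation) (hF : FeldmanPi)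
    (hMP : MahlerPopkenE) (hP : PairTypeSubcubic) : JointTypeSublinear := by
  sorry

end Summit.Schanuel.Schanuel.Cruxes.EPiSimultaneousType.BoundedDegreeRace
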